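import Literature.NumberTheory.EllipticCurves.ModularParamXFunction
import HarnessLib

/-!
# The modular function `y = ℘_Λ'(2πi∫f)` as an element of `K_N` (the bracket `G·F′ − F·G′`)

Topic `NumberTheory/EllipticCurves` (sixth file of the "canonical model of `X₀(N)` at CM points"
chain).  With `f ∈ S₂(Γ₀(N))` nonzero, `u = 2πi∫f`, `Λ ⊇ Λ_f` and a presentation
`℘_Λ(u)·G = F` by cusp forms `F, G ∈ S_k(Γ₀(N))` (`ModularParamXFunction`), the `y`-coordinate
`℘_Λ'(u)` of the analytic modular parametrisation is again a quotient of modular forms: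
differentiating `F = xG` gives `G·F′ − F·G′ = x′G² = ℘_Λ'(u)·u′·G² = ℘_Λ'(u)·2πi f·G²`.

* `serreDerivCusp F` — **the Serre derivative `ϑ_k F = D F − (k/12)E₂F` of a cusp form on `Γ₀(N)`
  is a cusp form of weight `k + 2`** (Mathlib's `serreDerivative_slash_equivariant`; at every cusp
  `D(F|γ) → 0` and `E₂ → 1`, `F|γ → 0`) (Zagier, *1-2-3*, §5.1 Prop. 15; Lang, *Modular Forms*, X §5);
* `bracketCusp F G = G·ϑF − F·ϑG = (2πi)⁻¹(G·F′ − F·G′)` — the first Rankin–Cohen bracket, a cusp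
  form of weight `2k + 2` (`bracketCusp_apply`);
* `IsXPresentation.yFn = bracketCusp F G / (f·G²) ∈ K_N` and **its value at a regular point**:
  `v_τ(yFn − ℘_Λ'(u(τ))) < 1` if `u(τ) ∉ Λ` (`pointValuation_yFn_sub_lt_one`).

Everything is proved; no named facts are introduced (Cremona 1997, §2.10: `x = ℘(u)`, `y = ℘′(u)`
with `dx/y = du = 2πi f dτ`).

## References

* D. Zagier, *Elliptic modular forms and their applications*, in: The 1-2-3 of Modular Forms,
  Universitext, 2008, §5.1 Prop. 15, §5.2. [Zagier123]
* J. E. Cremona, *Algorithms for modular elliptic curves*, 2nd ed., 1997, §2.10.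
  [CremonaAlgorithms1997]
-/

noncomputable section

open Complex Filter Topology Set Function
open UpperHalfPlane hiding I
open scoped Real Topology Manifold MatrixGroups PeriodPair ModularForm WithZero
open ModularForm CongruenceSubgroup Derivative

open Literature.NumberTheory.EllipticCurves

namespace Literature.NumberTheory.EllipticCurves.ModularForms

variable {N : ℕ} [NeZero N] {k : ℤ}

/-! ### The Serre derivative of a cusp form on `Γ₀(N)` -/

omit [NeZero N] in
/-- A cusp form on `Γ₀(N)` is invariant under `Γ₀(N) ≤ SL(2, ℤ)`. [folklore] -/
theorem cuspForm_slash_eq (F : CuspForm (Gamma0 N) k) {γ : SL(2, ℤ)} (hγ : γ ∈ Gamma0 N) :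
    (⇑F) ∣[k] γ = ⇑F := by
  rw [ModularForm.SL_slash]
  exact SlashInvariantForm.slash_action_eqn F _ (Subgroup.mem_map_of_mem (Matrix.SpecialLinearGroup.mapGL ℝ) hγ)

/-- The Serre derivative of an `SL(2, ℤ)`-translate of a cusp form on `Γ₀(N)` vanishes at `i∞`
(`D(F|γ) → 0` for the `N`-periodic cusp function `F|γ`, and `E₂ → 1`, `F|γ → 0`). [folklore] -/
theorem isZeroAtImInfty_serreDerivative_slash (F : CuspForm (Gamma0 N) k) (γ : SL(2, ℤ)) :
    IsZeroAtImInfty (serreDerivative k ((⇑F) ∣[k] γ)) := by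
  have hφ := isCuspFunction_slash F γ
  have h1 : IsZeroAtImInfty (D ((⇑F) ∣[k] γ)) :=
    isZeroAtImInfty_normalizedDeriv hφ.pos hφ.periodic hφ.mdifferentiable hφ.isBoundedAtImInfty
  have h2 : Tendsto (fun τ : ℍ ↦ (k : ℂ) * 12⁻¹ * EisensteinSeries.E2 τ * ((⇑F) ∣[k] γ) τ) atImInfty (𝓝 0) := by
    have := ((tendsto_E2_atImInfty.const_mul ((k : ℂ) * 12⁻¹)).mul hφ.isZeroAtImInfty)
    rw [mul_zero] at this
    exact this
  have hs : serreDerivative k ((⇑F) ∣[k] γ) = fun z ↦ D ((⇑F) ∣[k] γ) z -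
      k * 12⁻¹ * EisensteinSeries.E2 z * ((⇑F) ∣[k] γ) z := rfl
  rw [hs]
  have := h1.sub h2
  rw [sub_zero] at this
  exact this

/-- **The Serre derivative of a cusp form on `Γ₀(N)` is a cusp form of weight `k + 2`.**
(Zagier, *1-2-3*, §5.1 Prop. 15.) [folklore] -/
def serreDerivCusp (F : CuspForm (Gamma0 N) k) : CuspForm (Gamma0 N) (k + 2) where
  toFun := serreDerivative k F
  slash_action_eq' := fun A hA ↦ by
    obtain ⟨γ, hγ, rfl⟩ := hA
    exact serreDerivative_slash_invariant (k := k) (ModularFormClass.holo F) (γ := γ) (cuspForm_slash_eq F hγ)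
  holo' := serreDerivative_mdifferentiable k (ModularFormClass.holo F)
  zero_at_cusps' := fun {c} hc ↦ by
    rw [Subgroup.IsArithmetic.isCusp_iff_isCusp_SL2Z] at hc
    rw [OnePoint.isZeroAt_iff_forall_SL2Z hc]
    intro γ _
    rw [serreDerivative_slash_equivariant (k := k) (ModularFormClass.holo F)]
    exact isZeroAtImInfty_serreDerivative_slash F γ

/-- Pointwise formula. [folklore] -/
@[simp] theorem serreDerivCusp_apply (F : CuspForm (Gamma0 N) k) (τ : ℍ) :
    serreDerivCusp F τ = D F τ - k * 12⁻¹ * EisensteinSeries.E2 τ * F τ := rfl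

/-- The Serre derivative, as a function. [folklore] -/
theorem coe_serreDerivCusp (F : CuspForm (Gamma0 N) k) :
    (⇑(serreDerivCusp F) : ℍ → ℂ) = serreDerivative k F := rfl

/-! ### The bracket `G·ϑF − F·ϑG = (2πi)⁻¹ (G·F′ − F·G′)` -/

omit [NeZero N] in
/-- The bracket commutes with `SL(2, ℤ)`-translation (Serre-derivative equivariance). [folklore] -/
theorem bracket_slash (F G : CuspForm (Gamma0 N) k) (γ : SL(2, ℤ)) :
    (⇑G * serreDerivative k ⇑F - ⇑F * serreDerivative k ⇑G) ∣[k + (k + 2)] γ =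
      (⇑G ∣[k] γ) * serreDerivative k (⇑F ∣[k] γ) - (⇑F ∣[k] γ) * serreDerivative k (⇑G ∣[k] γ) := by
  rw [sub_eq_add_neg, SlashAction.add_slash, SlashAction.neg_slash, ModularForm.mul_slash_SL2,
    ModularForm.mul_slash_SL2, serreDerivative_slash_equivariant (k := k) (ModularFormClass.holo F),
    serreDerivative_slash_equivariant (k := k) (ModularFormClass.holo G), ← sub_eq_add_neg]

/-- **The first Rankin–Cohen bracket** `G·ϑF − F·ϑG = (2πi)⁻¹(G·F′ − F·G′)` of two cusp forms of
weight `k` on `Γ₀(N)`: a cusp form of weight `2k + 2` (Zagier, *1-2-3*, §5.2). [folklore] -/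
def bracketCusp (F G : CuspForm (Gamma0 N) k) : CuspForm (Gamma0 N) (k + (k + 2)) where
  toFun := ⇑G * serreDerivative k ⇑F - ⇑F * serreDerivative k ⇑G
  slash_action_eq' := fun A hA ↦ by
    obtain ⟨γ, hγ, rfl⟩ := hA
    change (⇑G * serreDerivative k ⇑F - ⇑F * serreDerivative k ⇑G) ∣[k + (k + 2)] γ = _
    rw [bracket_slash, cuspForm_slash_eq F hγ, cuspForm_slash_eq G hγ]
  holo' := ((ModularFormClass.holo G).mul (serreDerivative_mdifferentiable k (ModularFormClass.holo F))).sub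
    ((ModularFormClass.holo F).mul (serreDerivative_mdifferentiable k (ModularFormClass.holo G)))
  zero_at_cusps' := fun {c} hc ↦ by
    rw [Subgroup.IsArithmetic.isCusp_iff_isCusp_SL2Z] at hc
    rw [OnePoint.isZeroAt_iff_forall_SL2Z hc]
    intro γ _
    change IsZeroAtImInfty ((⇑G * serreDerivative k ⇑F - ⇑F * serreDerivative k ⇑G) ∣[k + (k + 2)] γ)
    rw [bracket_slash]
    have h1 : Tendsto (⇑G ∣[k] γ) atImInfty (𝓝 0) := (isCuspFunction_slash G γ).isZeroAtImInfty
    have h2 : Tendsto (serreDerivative k (⇑F ∣[k] γ)) atImInfty (𝓝 0) :=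
      isZeroAtImInfty_serreDerivative_slash F γ
    have h3 : Tendsto (⇑F ∣[k] γ) atImInfty (𝓝 0) := (isCuspFunction_slash F γ).isZeroAtImInfty
    have h4 : Tendsto (serreDerivative k (⇑G ∣[k] γ)) atImInfty (𝓝 0) :=
      isZeroAtImInfty_serreDerivative_slash G γ
    have := (h1.mul h2).sub (h3.mul h4)
    rw [mul_zero, sub_zero] at this
    exact this

/-- **`bracketCusp F G = (2πi)⁻¹ (G·F′ − F·G′)`** pointwise (the `E₂`-terms cancel). [folklore] -/
theorem bracketCusp_apply (F G : CuspForm (Gamma0 N) k) (τ : ℍ) :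
    bracketCusp F G τ = (2 * π * I)⁻¹ * (G τ * deriv (⇑F ∘ ofComplex) τ - F τ * deriv (⇑G ∘ ofComplex) τ) := by
  change (⇑G * serreDerivative k ⇑F - ⇑F * serreDerivative k ⇑G) τ = _
  simp only [Pi.sub_apply, Pi.mul_apply, serreDerivative_apply, normalizedDerivOfComplex]
  ring

/-- The bracket as a function. [folklore] -/
theorem coe_bracketCusp (F G : CuspForm (Gamma0 N) k) :
    (⇑(bracketCusp F G) : ℍ → ℂ) = ⇑G * serreDerivative k ⇑F - ⇑F * serreDerivative k ⇑G := rfl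

/-! ### `y = ℘_Λ'(u)` as the element `bracket / (G² f)` of `K_N` -/

namespace IsXPresentation

variable {f : CuspForm (Gamma0 N) 2} {L : PeriodPair} {F G : CuspForm (Gamma0 N) k}

/-- The denominator `G·G·f` of `y` (weight `2k + 2`). [folklore] -/
def yDen (_h : IsXPresentation f L F G) : ModularForm (Gamma0 N) (k + (k + 2)) :=
  (G : ModularForm (Gamma0 N) k).mul ((G : ModularForm (Gamma0 N) k).mul (f : ModularForm (Gamma0 N) 2))

/-- Pointwise formula for the denominator. [folklore] -/
theorem yDen_apply (h : IsXPresentation f L F G) (τ : ℍ) : h.yDen τ = G τ * (G τ * f τ) := rfl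

/-- The denominator is nonzero (for `f ≠ 0`). [folklore] -/
theorem yDen_ne_zero (h : IsXPresentation f L F G) (hf : f ≠ 0) : h.yDen ≠ 0 := by
  have hG := h.modularForm_ne_zero
  have hf' : (f : ModularForm (Gamma0 N) 2) ≠ 0 := by
    intro h0; apply hf; apply DFunLike.ext; intro τ; exact DFunLike.congr_fun h0 τ
  rw [yDen, Ne, ← qExpansionL_eq_zero_iff, qExpansionL_mul, qExpansionL_mul, mul_eq_zero, mul_eq_zero,
    qExpansionL_eq_zero_iff, qExpansionL_eq_zero_iff]
  tauto

/-- **The element `y = bracket/(G²f) ∈ K_N`** of a presentation (value `℘_Λ'(u)`, see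
`pointValuation_yFn_sub_lt_one`). [folklore] -/
def yFn (h : IsXPresentation f L F G) (hf : f ≠ 0) : modularFunctionField N :=
  mkFn (bracketCusp F G : ModularForm (Gamma0 N) (k + (k + 2))) h.yDen (h.yDen_ne_zero hf)

/-- Unfolding of `yFn`. [folklore] -/
theorem yFn_def (h : IsXPresentation f L F G) (hf : f ≠ 0) :
    h.yFn hf = mkFn (bracketCusp F G : ModularForm (Gamma0 N) (k + (k + 2))) h.yDen (h.yDen_ne_zero hf) :=
  rfl

/-- **Local form of the bracket**: near a regular point, `bracket = ℘_Λ'(u)·f·G²` (differentiate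
`F = ℘_Λ(u)·G`: `G·F′ − F·G′ = G²·(℘_Λ∘u)′ = G²·℘_Λ'(u)·2πi f`). [folklore] -/
theorem bracket_eventuallyEq (h : IsXPresentation f L F G) {z₀ : ℂ} (hz₀ : 0 < z₀.im)
    (hz₀L : eichlerIntegral f (ofComplex z₀) ∉ L.lattice) :
    (⇑(bracketCusp F G) ∘ ofComplex) =ᶠ[𝓝 z₀]
      fun z ↦ ℘'[L] (eichlerIntegral f (ofComplex z)) * ((⇑G ∘ ofComplex) z * ((⇑G ∘ ofComplex) z *
        f (ofComplex z))) := by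
  set Ω : Set ℂ := {z : ℂ | 0 < z.im ∧ eichlerIntegral f (ofComplex z) ∉ L.lattice} with hΩ
  have hΩo : IsOpen Ω := isOpen_setOf_eichlerIntegral_notMem_lattice f L
  have hΩz : Ω ∈ 𝓝 z₀ := hΩo.mem_nhds ⟨hz₀, hz₀L⟩
  filter_upwards [hΩz] with z hz
  set X : ℂ → ℂ := fun w ↦ ℘[L] (eichlerIntegral f (ofComplex w)) with hX
  set Fc : ℂ → ℂ := ⇑F ∘ ofComplex with hFc
  set Gc : ℂ → ℂ := ⇑G ∘ ofComplex with hGc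
  -- `Fc = X·Gc` near `z`
  have hev : Fc =ᶠ[𝓝 z] X * Gc := by
    filter_upwards [hΩo.mem_nhds hz] with w hw
    rw [hFc, h.apply_eq_mul hw.2]; rfl
  have hu := hasDerivAt_eichlerIntegral f hz.1
  have hXd : HasDerivAt X (℘'[L] (eichlerIntegral f (ofComplex z)) * (2 * π * Complex.I * f (ofComplex z))) z :=
    HasDerivAt.comp (h₂ := ℘[L]) (h := fun w : ℂ ↦ eichlerIntegral f (ofComplex w)) z
      (L.hasDerivAt_weierstrassP hz.2) hu
  have hGd : HasDerivAt Gc (deriv Gc z) z :=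
    ((isCuspFunction_one G).analyticAt_comp_ofComplex hz.1).differentiableAt.hasDerivAt
  have hFd : deriv Fc z = ℘'[L] (eichlerIntegral f (ofComplex z)) * (2 * π * Complex.I * f (ofComplex z)) * Gc z +
      X z * deriv Gc z := by
    rw [hev.deriv_eq]
    exact (hXd.mul hGd).deriv
  simp only [comp_apply, bracketCusp_apply]
  have hFz : F (ofComplex z) = X z * Gc z := by
    have := hev.self_of_nhds; simpa [hFc] using this
  rw [show deriv (⇑F ∘ ofComplex) (ofComplex z) = deriv Fc z by rw [ofComplex_apply_of_im_pos hz.1],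
    show deriv (⇑G ∘ ofComplex) (ofComplex z) = deriv Gc z by rw [ofComplex_apply_of_im_pos hz.1],
    hFd, hFz]
  have hGz : G (ofComplex z) = Gc z := rfl
  rw [hGz]
  have hπ : (2 * π * I : ℂ) ≠ 0 := by
    exact mul_ne_zero (mul_ne_zero two_ne_zero (ofReal_ne_zero.mpr Real.pi_ne_zero)) I_ne_zero
  field_simp
  ring

/-- `yDen` and the bracket minus a constant multiple, locally. [folklore] -/
theorem bracket_sub_smul_eventuallyEq (h : IsXPresentation f L F G) (c : ℂ) {z₀ : ℂ} (hz₀ : 0 < z₀.im)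
    (hz₀L : eichlerIntegral f (ofComplex z₀) ∉ L.lattice) :
    (⇑((bracketCusp F G : ModularForm (Gamma0 N) (k + (k + 2))) - c • h.yDen) ∘ ofComplex) =ᶠ[𝓝 z₀]
      (fun z ↦ ℘'[L] (eichlerIntegral f (ofComplex z)) - c) * (⇑h.yDen ∘ ofComplex) := by
  filter_upwards [h.bracket_eventuallyEq hz₀ hz₀L] with z hz
  have hB : ((bracketCusp F G : ModularForm (Gamma0 N) (k + (k + 2))) : ℍ → ℂ) = ⇑(bracketCusp F G) := rfl
  simp only [comp_apply, Pi.mul_apply, ModularForm.coe_sub, Pi.sub_apply,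
    ModularForm.IsGLPos.smul_apply, smul_eq_mul, hB, yDen_apply]
  rw [show (bracketCusp F G) (ofComplex z) = (⇑(bracketCusp F G) ∘ ofComplex) z from rfl, hz]
  simp only [comp_apply]
  ring

/-- **Value of `y` at a regular point**: if `u(τ) ∉ Λ` then `v_τ(y − ℘_Λ'(u(τ))) < 1` — so
`y ∈ O_{P_τ}` with value `℘_Λ'(u(τ))`. [folklore] -/
theorem pointValuation_yFn_sub_lt_one (h : IsXPresentation f L F G) (hf : f ≠ 0) (τ : ℍ)
    (hτ : eichlerIntegral f τ ∉ L.lattice) :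
    pointValuation (N := N) τ (h.yFn hf -
      algebraMap ℂ (modularFunctionField N) (℘'[L] (eichlerIntegral f τ))) < 1 := by
  set c := ℘'[L] (eichlerIntegral f τ) with hc
  apply pointValuation_mkFn_sub_lt_one_of_orderAt_lt
  set H : ModularForm (Gamma0 N) (k + (k + 2)) :=
    (bracketCusp F G : ModularForm (Gamma0 N) (k + (k + 2))) - c • h.yDen with hH
  by_cases hH0 : H = 0
  · exact Or.inl hH0
  right
  have hD0 := h.yDen_ne_zero hf
  set z₀ : ℂ := (τ : ℂ) with hz₀
  have hz₀im : 0 < z₀.im := τ.im_pos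
  have hz₀L : eichlerIntegral f (ofComplex z₀) ∉ L.lattice := by rwa [hz₀, ofComplex_apply]
  -- analytic factors
  have h℘' : AnalyticAt ℂ ℘'[L] (eichlerIntegral f (ofComplex z₀)) :=
    (L.differentiableOn_derivWeierstrassP.analyticOnNhd L.isClosed_lattice.isOpen_compl) _ hz₀L
  have hXan : AnalyticAt ℂ (fun z ↦ ℘'[L] (eichlerIntegral f (ofComplex z)) - c) z₀ :=
    (AnalyticAt.comp (g := ℘'[L]) (f := fun w : ℂ ↦ eichlerIntegral f (ofComplex w)) (x := z₀) h℘'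
      (analyticAt_eichlerIntegral_comp_ofComplex f hz₀im)).sub analyticAt_const
  have hDan : AnalyticAt ℂ (⇑h.yDen ∘ ofComplex) z₀ := analyticAt_comp_ofComplex (ModularFormClass.holo h.yDen) τ
  have hHeq := h.bracket_sub_smul_eventuallyEq c hz₀im hz₀L
  have hordH : (orderAt H τ : ℕ∞) = analyticOrderAt (fun z ↦ ℘'[L] (eichlerIntegral f (ofComplex z)) - c) z₀ +
      analyticOrderAt (⇑h.yDen ∘ ofComplex) z₀ := by
    rw [orderAt_eq hH0, hz₀, analyticOrderAt_congr hHeq, analyticOrderAt_mul hXan hDan]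
  have hordD : (orderAt h.yDen τ : ℕ∞) = analyticOrderAt (⇑h.yDen ∘ ofComplex) z₀ := orderAt_eq hD0 τ
  have hpos : 0 < analyticOrderAt (fun z ↦ ℘'[L] (eichlerIntegral f (ofComplex z)) - c) z₀ := by
    rw [pos_iff_ne_zero, Ne, hXan.analyticOrderAt_eq_zero]
    simp [hc, hz₀, ofComplex_apply]
  have hfinD : analyticOrderAt (⇑h.yDen ∘ ofComplex) z₀ ≠ ⊤ := by rw [← hordD]; exact ENat.coe_ne_top _
  have hfinX : analyticOrderAt (fun z ↦ ℘'[L] (eichlerIntegral f (ofComplex z)) - c) z₀ ≠ ⊤ := by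
    intro htop
    rw [htop, top_add] at hordH
    exact ENat.coe_ne_top _ hordH
  obtain ⟨n₁, hn₁⟩ := ENat.ne_top_iff_exists.mp hfinX
  obtain ⟨n₂, hn₂⟩ := ENat.ne_top_iff_exists.mp hfinD
  rw [← hn₁, ← hn₂, ← ENat.coe_add, Nat.cast_inj] at hordH
  rw [← hn₂, Nat.cast_inj] at hordD
  rw [← hn₁] at hpos
  have hn₁pos : 0 < n₁ := by exact_mod_cast hpos
  change orderAt h.yDen τ < orderAt H τ
  omega

/-- If `u(τ) ∉ Λ` then `y ∈ O_{P_τ}`. [folklore] -/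
theorem yFn_mem_pointPlace (h : IsXPresentation f L F G) (hf : f ≠ 0) (τ : ℍ)
    (hτ : eichlerIntegral f τ ∉ L.lattice) : h.yFn hf ∈ (pointPlace (N := N) τ).toValuationSubring :=
  mem_pointPlace_of_pointValuation_sub_lt_one (h.pointValuation_yFn_sub_lt_one hf τ hτ)

end IsXPresentation

end Literature.NumberTheory.EllipticCurves.ModularForms

end
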